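import Literature.Analysis.ODE.EulerL2Vanishing
import Literature.Analysis.Distribution.DivFormRegularity
import Literature.Analysis.Distribution.EllipticRegularityProofs
import Mathlib.Analysis.SpecialFunctions.Pow.Deriv
import HarnessLib

/-!
# Very weak solutions of the radial Euler equations are classical, and vanish in `L²`
([Elgindi2021] §7.1, proof of Proposition 7.1 Step 1: the radial equation of a mode)

Topic `Literature/Analysis/FluidPDE`. Proof file (everything proved, no definitions, no named
facts) on the proof path of the named fact
`Literature.Analysis.FluidPDE.Elgindi.ElgindiGhoulMasmoudi2021_stabilityCore`
(`ElgindiStabilityDecomposition.lean`). T. M. Elgindi, Ann. of Math. 194 (2021) =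
arXiv:1904.04795, §7.1 p. 19 ("`α²R²∂_{RR}Ψ⋆ + α(5+α)R∂_RΨ⋆ = 0` … it is easy to see that `Ψ⋆`
satisfies this ODE").

For the radial operators `P a = −α²R²a″ + βRa′ + c₀a` of the angular modes of `L` (`β = −α(5+α)`) and
of its transpose (`β = 5α − 3α²`) we prove:
* `exists_smooth_rep_of_local_real` — patching of local smooth representatives on an open
  subset of `ℝ`;
* `radialMode_classical` — a locally integrable `d` on `(0,∞)` with `∫ d·P(a) = 0` for all test
  functions `a` of `(0,∞)` agrees a.e. with a `C^∞((0,∞))` solution of the adjoint Euler equation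
  `−α²R²d″ − (4α² + β)Rd′ + (c₀ − 2α² − β)d = 0` (Folland's Cor. (6.34) in one variable, the
  tree's `exists_contDiffOn_ae_eq_of_divForm_weak` after the weight `w = R^{5/α − 1}` puts `P` in
  divergence form, plus two integrations by parts);
* `radialMode_ae_eq_zero` — **if moreover `∫₀^∞ d² < ∞` then `d = 0` a.e. on `(0,∞)`**
  (`eq_zero_of_euler_of_integrableOn_sq`).
-/

noncomputable section

open MeasureTheory Set Real Filter Function
open _root_.Topology
open scoped ContDiff

namespace Literature.Analysis.FluidPDE

namespace Elgindi

open Literature.Analysis.Distribution Literature.Analysis.ODE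

/-! ### Order bookkeeping -/

/-- `C^∞ ⇒ C²`. [folklore] -/
theorem contDiff_two_of_infty {φ : ℝ → ℝ} (h : ContDiff ℝ ∞ φ) : ContDiff ℝ 2 φ := by
  have := contDiff_infty.1 h 2; exact_mod_cast this

/-- `C^∞ ⇒ C¹`. [folklore] -/
theorem contDiff_one_of_infty {φ : ℝ → ℝ} (h : ContDiff ℝ ∞ φ) : ContDiff ℝ 1 φ := by
  have := contDiff_infty.1 h 1; exact_mod_cast this

/-- `C^∞ ⇒ C²` on a set. [folklore] -/
theorem contDiffOn_two_of_infty {φ : ℝ → ℝ} {s : Set ℝ} (h : ContDiffOn ℝ ∞ φ s) : ContDiffOn ℝ 2 φ s := by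
  have := contDiffOn_infty.1 h 2; exact_mod_cast this

/-! ### Patching on the line -/

/-- **Patching** of local smooth representatives on an open subset of `ℝ`. [folklore] -/
theorem exists_smooth_rep_of_local_real {Ω : Set ℝ} (hΩ : IsOpen Ω) {u : ℝ → ℝ}
    (hloc : ∀ x ∈ Ω, ∃ V : Set ℝ, IsOpen V ∧ x ∈ V ∧ V ⊆ Ω ∧
      ∃ g : ℝ → ℝ, ContDiffOn ℝ ∞ g V ∧ ∀ᵐ y ∂(volume : Measure ℝ), y ∈ V → u y = g y) :
    ∃ Ψ : ℝ → ℝ, ContDiffOn ℝ ∞ Ψ Ω ∧ ∀ᵐ y ∂(volume : Measure ℝ), y ∈ Ω → u y = Ψ y := by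
  classical
  have _hΩ := hΩ
  choose V hV hxV hVΩ g hg hae using hloc
  have hagree : ∀ x (hx : x ∈ Ω) y (hy : y ∈ Ω), EqOn (g x hx) (g y hy) (V x hx ∩ V y hy) := by
    intro x hx y hy
    have hO : IsOpen (V x hx ∩ V y hy) := (hV x hx).inter (hV y hy)
    refine Measure.eqOn_open_of_ae_eq (μ := (volume : Measure ℝ)) ?_ hO ((hg x hx).continuousOn.mono inter_subset_left)
      ((hg y hy).continuousOn.mono inter_subset_right)
    rw [Filter.EventuallyEq, ae_restrict_iff' hO.measurableSet]
    filter_upwards [hae x hx, hae y hy] with z h1 h2 hz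
    rw [← h1 hz.1, ← h2 hz.2]
  set Ψ : ℝ → ℝ := fun z => if hz : z ∈ Ω then g z hz z else 0 with hΨ
  have hΨV : ∀ x (hx : x ∈ Ω), ∀ z ∈ V x hx, Ψ z = g x hx z := by
    intro x hx z hz
    have hzΩ : z ∈ Ω := hVΩ x hx hz
    simp only [hΨ, dif_pos hzΩ]
    exact hagree z hzΩ x hx ⟨hxV z hzΩ, hz⟩
  refine ⟨Ψ, fun x hx => ?_, ?_⟩
  · have h1 : ContDiffAt ℝ ∞ (g x hx) x := (hg x hx).contDiffAt ((hV x hx).mem_nhds (hxV x hx))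
    have h2 : Ψ =ᶠ[𝓝 x] g x hx := by
      filter_upwards [(hV x hx).mem_nhds (hxV x hx)] with z hz using hΨV x hx z hz
    exact (h1.congr_of_eventuallyEq h2).contDiffWithinAt
  · obtain ⟨T, hTc, hTU⟩ := TopologicalSpace.isOpen_iUnion_countable (fun i : Ω => V i.1 i.2) fun i => hV i.1 i.2
    have hcov : Ω ⊆ ⋃ i ∈ T, V i.1 i.2 := by
      rw [hTU]; intro z hz; exact mem_iUnion.2 ⟨⟨z, hz⟩, hxV z hz⟩
    haveI : Countable T := hTc.to_subtype
    have hall : ∀ᵐ y ∂(volume : Measure ℝ), ∀ i : T, y ∈ V i.1.1 i.1.2 → u y = g i.1.1 i.1.2 y :=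
      ae_all_iff.2 fun i => hae i.1.1 i.1.2
    filter_upwards [hall] with y hy hyΩ
    obtain ⟨i, hi⟩ := mem_iUnion.1 (hcov hyΩ)
    obtain ⟨hiT, hyi⟩ := mem_iUnion.1 hi
    rw [hy ⟨i, hiT⟩ hyi, hΨV i.1 i.2 y hyi]

/-! ### The radial operator and its weight -/

/-- The divergence coefficient `A(R) = α²R^{−β/α²}` has `A′ = −βR·R^{−β/α²−2}` on `R > 0`. [folklore] -/
theorem hasDerivAt_rpow_radial (α β : ℝ) (hα : α ≠ 0) {R : ℝ} (hR : 0 < R) :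
    HasDerivAt (fun R : ℝ => α ^ 2 * R ^ (-β / α ^ 2)) (-β * R * R ^ (-β / α ^ 2 - 2)) R := by
  have h := (Real.hasDerivAt_rpow_const (p := -β / α ^ 2) (Or.inl hR.ne')).const_mul (α ^ 2)
  refine h.congr_deriv ?_
  have e : R ^ (-β / α ^ 2 - 1) = R * R ^ (-β / α ^ 2 - 2) := by
    rw [show -β / α ^ 2 - 1 = (-β / α ^ 2 - 2) + 1 by ring, Real.rpow_add_one hR.ne']; ring
  rw [e]
  have hc : α ^ 2 * (-β / α ^ 2) = -β := by field_simp
  calc α ^ 2 * (-β / α ^ 2 * (R * R ^ (-β / α ^ 2 - 2))) = (α ^ 2 * (-β / α ^ 2)) * (R * R ^ (-β / α ^ 2 - 2)) := by ring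
    _ = _ := by rw [hc]; ring

/-- **The radial operator in divergence form**: with `w = R^{−β/α²−2}`, on `R > 0`,
`∂_R(α²R^{−β/α²}a′) − w c₀ a = −w·(−α²R²a″ + βRa′ + c₀a)`. [folklore] -/
theorem radial_divForm_identity (α β c₀ : ℝ) (hα : α ≠ 0) {a : ℝ → ℝ} (ha : ContDiff ℝ 2 a) {R : ℝ} (hR : 0 < R) :
    deriv (fun y => α ^ 2 * y ^ (-β / α ^ 2) * deriv a y) R - R ^ (-β / α ^ 2 - 2) * c₀ * a R =
      -(R ^ (-β / α ^ 2 - 2)) * (-α ^ 2 * R ^ 2 * deriv (deriv a) R + β * R * deriv a R + c₀ * a R) := by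
  have ha1 : ContDiff ℝ 1 (deriv a) := by have := ha.iterate_deriv' 1 1; simpa using this
  have hda' : Differentiable ℝ (deriv a) := ha1.differentiable (by norm_num)
  have h : HasDerivAt (fun y => α ^ 2 * y ^ (-β / α ^ 2) * deriv a y)
      (-β * R * R ^ (-β / α ^ 2 - 2) * deriv a R + α ^ 2 * R ^ (-β / α ^ 2) * deriv (deriv a) R) R :=
    (hasDerivAt_rpow_radial α β hα hR).mul (hda' R).hasDerivAt
  rw [h.deriv]
  have e : R ^ (-β / α ^ 2) = R ^ 2 * R ^ (-β / α ^ 2 - 2) := by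
    rw [show -β / α ^ 2 = (-β / α ^ 2 - 2) + 2 by ring, Real.rpow_add hR, Real.rpow_two]; ring
  rw [e]; ring

/-! ### Very weak radial modes are classical -/

set_option maxHeartbeats 1600000 in
/-- **Very weak solutions of the radial mode equation are classical**: if `d ∈ L¹_loc((0,∞))`
satisfies `∫ d·(−α²R²a″ + βRa′ + c₀a) dR = 0` for all smooth `a` compactly supported in
`(0,∞)` (`α > 0`), then `d` agrees a.e. on `(0,∞)` with a smooth solution of the adjoint Euler
equation `−α²R²d″ − (4α² + β)Rd′ + (c₀ − 2α² − β)d = 0`. [cite: Elgindi2021, §7.1 proof of Proposition 7.1, Step 1 (p. 19 of arXiv:1904.04795), via Folland 1995 Cor. (6.34)] -/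
theorem radialMode_classical {α : ℝ} (hα : 0 < α) (β c₀ : ℝ) {d : ℝ → ℝ} (hd : LocallyIntegrableOn d (Ioi 0))
    (hvw : ∀ a : ℝ → ℝ, ContDiff ℝ ∞ a → HasCompactSupport a → tsupport a ⊆ Ioi 0 →
      ∫ R in Ioi 0, d R * (-α ^ 2 * R ^ 2 * deriv (deriv a) R + β * R * deriv a R + c₀ * a R) = 0) :
    ∃ g : ℝ → ℝ, ContDiffOn ℝ ∞ g (Ioi 0) ∧ (∀ᵐ R ∂(volume : Measure ℝ), R ∈ Ioi 0 → d R = g R) ∧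
      ∀ R, 0 < R → -α ^ 2 * R ^ 2 * deriv (deriv g) R + (-4 * α ^ 2 - β) * R * deriv g R + (-2 * α ^ 2 - β + c₀) * g R = 0 := by
  ----------------------------------------------------------------
  -- Step 1: local smoothness through Folland's theorem in one variable
  ----------------------------------------------------------------
  set w : ℝ → ℝ := fun R => R ^ (-β / α ^ 2 - 2) with hw
  have hwpos : ∀ R, 0 < R → 0 < w R := fun R hR => Real.rpow_pos_of_pos hR _
  have hwC : ContDiffOn ℝ ∞ w (Ioi 0) := fun R hR =>
    (Real.contDiffAt_rpow_const_of_ne (p := -β / α ^ 2 - 2) (ne_of_gt hR)).contDiffWithinAt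
  set A : Fin 1 → Fin 1 → ℝ → ℝ := fun _ _ y => α ^ 2 * y ^ (-β / α ^ 2) with hA
  set cc : ℝ → ℝ := fun y => w y * c₀ with hcc
  set b := Module.Basis.singleton (Fin 1) ℝ with hb
  have hb0 : ∀ i : Fin 1, b i = 1 := fun i => Module.Basis.singleton_apply _ _ i
  have hAC : ∀ i j, ContDiffOn ℝ ∞ (A i j) (Ioi 0) := fun _ _ R hR =>
    ((Real.contDiffAt_rpow_const_of_ne (p := -β / α ^ 2) (ne_of_gt hR)).const_smul (α ^ 2)).contDiffWithinAt.congr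
      (fun y _ => by simp [hA, smul_eq_mul]) (by simp [hA, smul_eq_mul])
  have hApos : ∀ x ∈ Ioi (0:ℝ), ∀ v : Fin 1 → ℝ, v ≠ 0 → 0 < ∑ i, ∑ j, A i j x * (v i * v j) := by
    intro x hx v hv
    simp only [Fin.sum_univ_one, hA]
    have hv0 : v 0 ≠ 0 := fun h => hv (funext fun i => by fin_cases i; simpa using h)
    have : 0 < v 0 * v 0 := mul_self_pos.2 hv0
    exact mul_pos (mul_pos (pow_pos hα 2) (Real.rpow_pos_of_pos hx _)) this
  have hccC : ContDiffOn ℝ ∞ cc (Ioi 0) := hwC.mul contDiffOn_const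
  have hu : LocallyIntegrableOn (fun R => d R / w R) (Ioi 0) volume := by
    rw [locallyIntegrableOn_iff isOpen_Ioi.isLocallyClosed] at hd ⊢
    intro k hk hkc
    have h3 : ContinuousOn (fun R => (w R)⁻¹) k := (hwC.continuousOn.mono hk).inv₀ fun R hR => (hwpos R (hk hR)).ne'
    simpa [div_eq_mul_inv] using (hd k hk hkc).mul_continuousOn h3 hkc
  have hweak : ∀ φ : ℝ → ℝ, ContDiff ℝ ∞ φ → HasCompactSupport φ → tsupport φ ⊆ Ioi 0 →
      ∫ x, (fun R => d R / w R) x * ((∑ i, ∑ j, fderiv ℝ (fun y => A i j y * fderiv ℝ φ y (b i)) x (b j)) - cc x * φ x) =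
        ∫ x, (fun _ => (0:ℝ)) x * φ x := by
    intro φ hφ hφs hφS
    simp only [zero_mul, integral_zero]
    have hφ2 : ContDiff ℝ 2 φ := contDiff_two_of_infty hφ
    -- reduce to the strip `(0,∞)` and use the divergence identity
    have hfd : ∀ y, fderiv ℝ φ y 1 = deriv φ y := fun y => rfl
    have e1 : ∀ x, (∑ i, ∑ j, fderiv ℝ (fun y => A i j y * fderiv ℝ φ y (b i)) x (b j)) =
        deriv (fun y => α ^ 2 * y ^ (-β / α ^ 2) * deriv φ y) x := by
      intro x
      simp only [Fin.sum_univ_one, hb0, hA, hfd]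
      rfl
    simp_rw [e1]
    have l0 : ∀ x, x ∉ Ioi (0:ℝ) → d x / w x * (deriv (fun y => α ^ 2 * y ^ (-β / α ^ 2) * deriv φ y) x - cc x * φ x) = 0 := by
      intro x hx
      have hxs : x ∉ tsupport φ := fun h => hx (hφS h)
      have hopen : IsOpen (tsupport φ)ᶜ := (isClosed_tsupport _).isOpen_compl
      have hφ0 : φ x = 0 := image_eq_zero_of_notMem_tsupport hxs
      have hD0 : (fun y => α ^ 2 * y ^ (-β / α ^ 2) * deriv φ y) =ᶠ[𝓝 x] fun _ => 0 := by
        filter_upwards [hopen.mem_nhds hxs] with y hy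
        have : y ∉ tsupport (deriv φ) := fun h => hy (tsupport_deriv_subset h)
        rw [image_eq_zero_of_notMem_tsupport this, mul_zero]
      rw [hD0.deriv_eq, deriv_const, hφ0]; ring
    rw [← setIntegral_eq_integral_of_forall_compl_eq_zero (s := Ioi (0:ℝ)) fun x hx => l0 x hx]
    have e2 : ∫ x in Ioi (0:ℝ), d x / w x * (deriv (fun y => α ^ 2 * y ^ (-β / α ^ 2) * deriv φ y) x - cc x * φ x) =
        -∫ x in Ioi (0:ℝ), d x * (-α ^ 2 * x ^ 2 * deriv (deriv φ) x + β * x * deriv φ x + c₀ * φ x) := by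
      rw [← MeasureTheory.integral_neg]
      refine setIntegral_congr_fun measurableSet_Ioi fun x hx => ?_
      have hwx : w x ≠ 0 := (hwpos x hx).ne'
      have h := radial_divForm_identity α β c₀ hα.ne' hφ2 hx
      show d x / w x * (deriv (fun y => α ^ 2 * y ^ (-β / α ^ 2) * deriv φ y) x - w x * c₀ * φ x) =
        -(d x * (-α ^ 2 * x ^ 2 * deriv (deriv φ) x + β * x * deriv φ x + c₀ * φ x))
      rw [show deriv (fun y => α ^ 2 * y ^ (-β / α ^ 2) * deriv φ y) x - w x * c₀ * φ x =
        -(w x) * (-α ^ 2 * x ^ 2 * deriv (deriv φ) x + β * x * deriv φ x + c₀ * φ x) from h]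
      field_simp
    rw [e2, hvw φ hφ hφs hφS, neg_zero]
  ----------------------------------------------------------------
  -- Step 2: a smooth representative on `(0,∞)`
  ----------------------------------------------------------------
  have hloc : ∀ x ∈ Ioi (0:ℝ), ∃ V : Set ℝ, IsOpen V ∧ x ∈ V ∧ V ⊆ Ioi 0 ∧
      ∃ g : ℝ → ℝ, ContDiffOn ℝ ∞ g V ∧ ∀ᵐ y ∂(volume : Measure ℝ), y ∈ V → d y = g y := by
    intro x hx
    obtain ⟨V, hV, hxV, hVS, g, hg, hae⟩ := exists_contDiffOn_ae_eq_of_divForm_weak (μ := (volume : Measure ℝ)) (b := b)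
      Folland1995_cor634_holds isOpen_Ioi (a := A) hAC hApos hccC (contDiffOn_const (c := (0:ℝ))) hu hweak hx
    refine ⟨V, hV, hxV, hVS, fun y => w y * g y, (hwC.mono hVS).mul hg, ?_⟩
    filter_upwards [hae] with y hy hyV
    have h := hy hyV
    have hw0 : w y ≠ 0 := (hwpos y (hVS hyV)).ne'
    field_simp at h
    linarith [h]
  obtain ⟨g, hg, hae⟩ := exists_smooth_rep_of_local_real isOpen_Ioi hloc
  refine ⟨g, hg, hae, ?_⟩
  ----------------------------------------------------------------
  -- Step 3: the classical adjoint equation (two integrations by parts + fundamental lemma)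
  ----------------------------------------------------------------
  have hg2 : ContDiffOn ℝ 2 g (Ioi 0) := contDiffOn_two_of_infty hg
  have hg1 : ContDiffOn ℝ 1 (deriv g) (Ioi 0) := hg2.deriv_of_isOpen (m := 1) isOpen_Ioi (by norm_num)
  have hg0' : ContDiffOn ℝ 0 (deriv (deriv g)) (Ioi 0) := hg1.deriv_of_isOpen (m := 0) isOpen_Ioi (by norm_num)
  have hgd : ∀ R, 0 < R → HasDerivAt g (deriv g R) R := fun R hR =>
    ((hg2.differentiableOn (by norm_num)).differentiableAt (Ioi_mem_nhds hR)).hasDerivAt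
  have hgd' : ∀ R, 0 < R → HasDerivAt (deriv g) (deriv (deriv g) R) R := fun R hR =>
    ((hg1.differentiableOn (by norm_num)).differentiableAt (Ioi_mem_nhds hR)).hasDerivAt
  set Q : ℝ → ℝ := fun R => -α ^ 2 * R ^ 2 * deriv (deriv g) R + (-4 * α ^ 2 - β) * R * deriv g R + (-2 * α ^ 2 - β + c₀) * g R with hQ
  have hQc : ContinuousOn Q (Ioi 0) := by
    have c0 := hg.continuousOn
    have c1 := hg1.continuousOn
    have c2 := hg0'.continuousOn
    simp only [hQ]
    exact (((continuousOn_const.mul (continuousOn_id.pow 2)).mul c2).add ((continuousOn_const.mul continuousOn_id).mul c1)).add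
      (continuousOn_const.mul c0)
  -- the pairing of `Q` with every test function vanishes
  have hpair : ∀ φ : ℝ → ℝ, ContDiff ℝ ∞ φ → HasCompactSupport φ → tsupport φ ⊆ Ioi 0 →
      ∫ x, φ x • Q x ∂(volume : Measure ℝ) = 0 := by
    intro φ hφ hφs hφS
    have hφ2 : ContDiff ℝ 2 φ := contDiff_two_of_infty hφ
    have hφ1 : ContDiff ℝ 1 φ := contDiff_one_of_infty hφ
    have hdφ : Differentiable ℝ φ := hφ1.differentiable (by norm_num)
    have hφ1' : ContDiff ℝ 1 (deriv φ) := by have := hφ2.iterate_deriv' 1 1; simpa using this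
    have hdφ' : Differentiable ℝ (deriv φ) := hφ1'.differentiable (by norm_num)
    have hφ's : HasCompactSupport (deriv φ) := hφs.deriv
    have hφ'S : tsupport (deriv φ) ⊆ Ioi 0 := tsupport_deriv_subset.trans hφS
    -- off `(0,∞)` and on it
    have off : ∀ {ψ : ℝ → ℝ}, tsupport ψ ⊆ Ioi 0 → ∀ x, x ∉ Ioi (0:ℝ) → ψ x = 0 := fun {ψ} hψ x hx =>
      image_eq_zero_of_notMem_tsupport fun h => hx (hψ h)
    -- the two boundary functions `F₁ = R²gφ' − (R²g)'φ`… realised as globally `C¹` products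
    -- (i) `∫ g·(R²φ'') = ∫ (R²g)'' φ` and (ii) `∫ g·(Rφ') = −∫ (Rg)' φ`, done at once through
    -- `H := α²(R²g φ' − (2Rg + R²g')φ)·(−1) … `; we directly verify `∫ (d/dR H) = 0` for
    -- `H = -α²(R²g·φ' − (2Rg + R²g')φ) − α(5+α)Rgφ`.
    set H : ℝ → ℝ := fun R => -α ^ 2 * (R ^ 2 * g R * deriv φ R - (2 * R * g R + R ^ 2 * deriv g R) * φ R) +
      β * (R * g R * φ R) with hH
    set H' : ℝ → ℝ := fun R => g R * (-α ^ 2 * R ^ 2 * deriv (deriv φ) R + β * R * deriv φ R + c₀ * φ R) - Q R * φ R with hH'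
    have hHd : ∀ R, 0 < R → HasDerivAt H (H' R) R := by
      intro R hR
      have h1 : HasDerivAt (fun R => R ^ 2 * g R * deriv φ R) (((2:ℕ) * R ^ 1 * g R + R ^ 2 * deriv g R) * deriv φ R + R ^ 2 * g R * deriv (deriv φ) R) R :=
        (((hasDerivAt_pow 2 R).mul (hgd R hR)).mul (hdφ' R).hasDerivAt)
      have h2 : HasDerivAt (fun R => (2 * R * g R + R ^ 2 * deriv g R) * φ R)
          (((2 * 1 * g R + 2 * R * deriv g R) + ((2:ℕ) * R ^ 1 * deriv g R + R ^ 2 * deriv (deriv g) R)) * φ R +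
            (2 * R * g R + R ^ 2 * deriv g R) * deriv φ R) R :=
        ((((hasDerivAt_id R).const_mul 2).mul (hgd R hR)).add ((hasDerivAt_pow 2 R).mul (hgd' R hR))).mul (hdφ R).hasDerivAt
      have h3 : HasDerivAt (fun R => R * g R * φ R) ((1 * g R + R * deriv g R) * φ R + R * g R * deriv φ R) R :=
        (((hasDerivAt_id R).mul (hgd R hR)).mul (hdφ R).hasDerivAt)
      have := ((h1.sub h2).const_mul (-α ^ 2)).add (h3.const_mul β)
      refine this.congr_deriv ?_
      simp only [hH', hQ, pow_one, Nat.cast_ofNat]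
      ring
    -- `H` vanishes off `(0,∞)` hence near `0⁻`, and is compactly supported: extend the derivative statement to all of `ℝ`
    have hH0 : ∀ R, R ∉ Ioi (0:ℝ) → H R = 0 := fun R hR => by
      simp only [hH, off hφS R hR, off hφ'S R hR]; ring
    have hH'0 : ∀ R, R ∉ Ioi (0:ℝ) → H' R = 0 := fun R hR => by
      have h3 : deriv (deriv φ) R = 0 := image_eq_zero_of_notMem_tsupport fun h => hR ((tsupport_deriv_subset.trans hφ'S) h)
      simp only [hH', off hφS R hR, off hφ'S R hR, h3]; ring
    obtain ⟨r, hr, hrφ⟩ : ∃ r : ℝ, 0 < r ∧ ∀ R, R ≤ r → R ∉ tsupport φ := by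
      have hK : IsCompact (tsupport φ) := hφs
      by_cases hne : (tsupport φ).Nonempty
      · obtain ⟨m, hm, hmin⟩ := hK.exists_isMinOn hne continuous_id.continuousOn
        refine ⟨m / 2, by have := hφS hm; simp at this; linarith, fun R hR h => ?_⟩
        have := hmin h; simp at this
        have hm0 : 0 < m := hφS hm
        linarith
      · exact ⟨1, one_pos, fun R _ h => hne ⟨R, h⟩⟩
    have hHd_all : ∀ R, HasDerivAt H (H' R) R := by
      intro R
      by_cases hR : 0 < R
      · exact hHd R hR
      · -- near `R ≤ 0 < r`, `H ≡ 0`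
        have hev : H =ᶠ[𝓝 R] fun _ => 0 := by
          filter_upwards [Iio_mem_nhds (show R < r by linarith)] with y hy
          by_cases hy0 : 0 < y
          · have hyφ : y ∉ tsupport φ := hrφ y hy.le
            have hyφ' : y ∉ tsupport (deriv φ) := fun h => hyφ (tsupport_deriv_subset h)
            simp only [hH, image_eq_zero_of_notMem_tsupport hyφ, image_eq_zero_of_notMem_tsupport hyφ']; ring
          · exact hH0 y hy0
        have h0 : HasDerivAt (fun _ : ℝ => (0:ℝ)) 0 R := hasDerivAt_const R 0
        rw [hH'0 R hR]
        exact h0.congr_of_eventuallyEq hev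
    have hsuppH : support H ⊆ tsupport φ := by
      intro y hy
      by_contra h
      have h1 : φ y = 0 := image_eq_zero_of_notMem_tsupport h
      have h2 : deriv φ y = 0 := image_eq_zero_of_notMem_tsupport fun h' => h (tsupport_deriv_subset h')
      apply hy
      simp only [hH, h1, h2]; ring
    have hHs : HasCompactSupport H := HasCompactSupport.of_support_subset_isCompact hφs.isCompact hsuppH
    -- integrability of `H'` (continuous on `(0,∞)`, supported in `tsupport φ`)
    have hTc : Continuous fun R => -α ^ 2 * R ^ 2 * deriv (deriv φ) R + β * R * deriv φ R + c₀ * φ R := by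
      have := hφ1'.continuous_deriv le_rfl; have := hφ1'.continuous; have := hφ.continuous; fun_prop
    have hH'c : ContinuousOn H' (Ioi 0) := by
      simp only [hH']
      exact (hg.continuousOn.mul hTc.continuousOn).sub (hQc.mul hφ.continuous.continuousOn)
    have hH'supp : ∀ x, x ∉ tsupport φ → H' x = 0 := fun x hx => by
      have h1 : φ x = 0 := image_eq_zero_of_notMem_tsupport hx
      have h2 : deriv φ x = 0 := image_eq_zero_of_notMem_tsupport fun h' => hx (tsupport_deriv_subset h')
      have h3 : deriv (deriv φ) x = 0 := image_eq_zero_of_notMem_tsupport fun h' => hx (tsupport_deriv_subset (tsupport_deriv_subset h'))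
      simp only [hH', h1, h2, h3]; ring
    have hH'K : IntegrableOn H' (tsupport φ) := (hH'c.mono hφS).integrableOn_compact hφs.isCompact
    have hH'i : Integrable H' := hH'K.integrable_of_forall_notMem_eq_zero hH'supp
    -- `∫ H' = 0`
    have hlim : Tendsto H (cocompact ℝ) (𝓝 0) := hHs.is_zero_at_infty
    have hint0 : ∫ x, H' x = 0 := by
      have := integral_of_hasDerivAt_of_tendsto hHd_all hH'i (hlim.mono_left atBot_le_cocompact) (hlim.mono_left atTop_le_cocompact)
      rw [sub_zero] at this; exact this
    -- unpack `∫ H' = ∫_{(0,∞)} d·T − ∫ φ Q`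
    have hT'K : IntegrableOn (fun R => g R * (-α ^ 2 * R ^ 2 * deriv (deriv φ) R + β * R * deriv φ R + c₀ * φ R)) (tsupport φ) :=
      ((hg.continuousOn.mono hφS).mul hTc.continuousOn).integrableOn_compact hφs.isCompact
    have hTsupp : ∀ x, x ∉ tsupport φ → g x * (-α ^ 2 * x ^ 2 * deriv (deriv φ) x + β * x * deriv φ x + c₀ * φ x) = 0 := fun x hx => by
      have h1 : φ x = 0 := image_eq_zero_of_notMem_tsupport hx
      have h2 : deriv φ x = 0 := image_eq_zero_of_notMem_tsupport fun h' => hx (tsupport_deriv_subset h')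
      have h3 : deriv (deriv φ) x = 0 := image_eq_zero_of_notMem_tsupport fun h' => hx (tsupport_deriv_subset (tsupport_deriv_subset h'))
      simp only [h1, h2, h3]; ring
    have hTi : Integrable fun R => g R * (-α ^ 2 * R ^ 2 * deriv (deriv φ) R + β * R * deriv φ R + c₀ * φ R) :=
      hT'K.integrable_of_forall_notMem_eq_zero hTsupp
    have hQφK : IntegrableOn (fun R => Q R * φ R) (tsupport φ) := ((hQc.mono hφS).mul hφ.continuous.continuousOn).integrableOn_compact hφs.isCompact
    have hQφi : Integrable fun R => Q R * φ R :=
      hQφK.integrable_of_forall_notMem_eq_zero fun x hx => by rw [image_eq_zero_of_notMem_tsupport hx, mul_zero]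
    have hsplit : ∫ x, H' x = (∫ x, g x * (-α ^ 2 * x ^ 2 * deriv (deriv φ) x + β * x * deriv φ x + c₀ * φ x)) - ∫ x, Q x * φ x := by
      rw [← integral_sub hTi hQφi]
    -- the first integral is the very weak pairing with `d`
    have hfirst : ∫ x, g x * (-α ^ 2 * x ^ 2 * deriv (deriv φ) x + β * x * deriv φ x + c₀ * φ x) = 0 := by
      rw [← setIntegral_eq_integral_of_forall_compl_eq_zero (s := Ioi (0:ℝ)) fun x hx => hTsupp x fun h => hx (hφS h)]
      refine Eq.trans ?_ (hvw φ hφ hφs hφS)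
      refine integral_congr_ae ?_
      have hae' : ∀ᵐ x ∂(volume.restrict (Ioi (0:ℝ))), d x = g x := (ae_restrict_iff' measurableSet_Ioi).2 hae
      filter_upwards [hae'] with x hx
      rw [hx]
    rw [hsplit, hfirst, zero_sub, neg_eq_zero] at hint0
    rw [← hint0]
    refine integral_congr_ae (ae_of_all _ fun x => ?_)
    show φ x • Q x = Q x * φ x
    rw [smul_eq_mul, mul_comm]
  -- fundamental lemma of the calculus of variations on `(0,∞)`, then continuity
  have hae0 := isOpen_Ioi.ae_eq_zero_of_integral_contDiff_smul_eq_zero (hQc.locallyIntegrableOn measurableSet_Ioi) hpair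
  have hEq0 : EqOn Q 0 (Ioi 0) := by
    refine Measure.eqOn_open_of_ae_eq (μ := (volume : Measure ℝ)) ?_ isOpen_Ioi hQc continuousOn_const
    exact (ae_restrict_iff' measurableSet_Ioi).2 hae0
  intro R hR
  have := hEq0 hR
  simpa [hQ] using this

/-- **`L²` very weak radial modes vanish**: under the hypotheses of `radialMode_classical`, if
moreover `∫₀^∞ d² < ∞` (and `α ≠ 0`), then `d = 0` a.e. on `(0,∞)`. [cite: Elgindi2021, §7.1 proof of Proposition 7.1, Step 1 (p. 19 of arXiv:1904.04795)] -/
theorem radialMode_ae_eq_zero {α : ℝ} (hα : 0 < α) (β c₀ : ℝ) {d : ℝ → ℝ} (hd : LocallyIntegrableOn d (Ioi 0))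
    (hvw : ∀ a : ℝ → ℝ, ContDiff ℝ ∞ a → HasCompactSupport a → tsupport a ⊆ Ioi 0 →
      ∫ R in Ioi 0, d R * (-α ^ 2 * R ^ 2 * deriv (deriv a) R + β * R * deriv a R + c₀ * a R) = 0)
    (hL2 : IntegrableOn (fun R => d R ^ 2) (Ioi 0)) :
    ∀ᵐ R ∂(volume : Measure ℝ), R ∈ Ioi 0 → d R = 0 := by
  obtain ⟨g, hg, hae, hode⟩ := radialMode_classical hα β c₀ hd hvw
  have hg2 : ContDiffOn ℝ 2 g (Ioi 0) := contDiffOn_two_of_infty hg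
  have hgL2 : IntegrableOn (fun R => g R ^ 2) (Ioi 0) := by
    refine hL2.congr_fun_ae ?_
    have hae' : ∀ᵐ x ∂(volume.restrict (Ioi (0:ℝ))), d x = g x := (ae_restrict_iff' measurableSet_Ioi).2 hae
    filter_upwards [hae'] with x hx
    rw [hx]
  have hode' : ∀ R, 0 < R → α ^ 2 * R ^ 2 * deriv (deriv g) R + (-(-4 * α ^ 2 - β)) * R * deriv g R + (-(-2 * α ^ 2 - β + c₀)) * g R = 0 :=
    fun R hR => by have := hode R hR; linarith
  have hz := eq_zero_of_euler_of_integrableOn_sq hg2 hα.ne' hode' hgL2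
  filter_upwards [hae] with R hR hR0
  rw [hR hR0, hz R hR0]

end Elgindi

end Literature.Analysis.FluidPDE
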